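import Mathlib
import Summits.Ventures.PercRepro.TriangleCapTEven
import Summits.Ventures.PercRepro.TriangleCapOutDeg

/-!
# PercRepro — the row `m = k + 3` of the `K₄⁻`-free cherry table: `Σ_v C(d(v), 2) ≤ C(k − 1, 2) + 8` for every
`K₄⁻`-free graph with `k + 3` edges on `k ≥ 9` vertices (p3, gen 31; part 7 of the row `m = k + 3`)

The census reads `(9, 12) 36 = C(8, 2) + 8` (the windmill `W₄` = the star plus four disjoint leaf edges, tied by
`K_{2,5}` plus two pendant edges), while `(7, 10) 25` and `(8, 11) 30` are complete-bipartite values above the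
star pattern — hence the hypothesis `k ≥ 9`.  **`cherries_le_choose_two_add_eight_of_k4mFree`**: if every degree
is `≤ 4` then `2·cherries ≤ 3 Σ d = 6m`, i.e. `cherries ≤ 3k + 9 ≤ C(k − 1, 2) + 8`; otherwise at a vertex `v` of
MAXIMUM degree `d = a + 5` (`k = a + 6 + g`, `m = a + 9 + g`, `|R| = 2g + 8`, `m′ = g + 4`) the counts give
`4·cherries ≤ 4(C(k − 1, 2) + 8) + 2T + 8 − Y − 4ag`, and `2T + 8 ≤ Y + 4ag` in every case: `T ≥ 8` by
`T² ≤ 2Y + 2T` (TriangleCapTEven); `T = 6` by the same with `ag ≥ 2`; `T = 4` with `a ≥ 1` by `Y ≥ |R|`;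
`T ≤ 4` with `a = 0` (maximum degree `5`) by the defect sum seen from a vertex `c` of maximum off-degree `δ`
(TriangleCapOutDeg: `δ ≥ 4` gives `Y ≥ 4(m′ − δ)(δ − 2) ≥ 16`, `δ ≤ 3` gives `Y ≥ |R|(m′ − 5) ≥ 28`); `T = 2`
with `a, g ≥ 1` by `Y ≥ 4` (two disjoint edges off `v`) and `ag ≥ 2`; `T` odd is impossible; the dominating
case `g = 0` forces `T = |R| = 8`.  The extremal graphs are the companion module TriangleCapStarPlusFour.
Axioms: standard.
-/

namespace PercRepro

namespace TriangleCap

namespace C047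

open Finset

variable {V : Type*} [Fintype V] [DecidableEq V]

/-- `2·C(d, 2) ≤ 3d` for `d ≤ 4`. -/
theorem two_mul_choose_two_le_three_mul_of_le_four (d : ℕ) (h : d ≤ 4) : 2 * d.choose 2 ≤ 3 * d := by
  interval_cases d <;> decide

/-- `3k + 9 ≤ C(k − 1, 2) + 8` for `k ≥ 9`. -/
theorem three_mul_add_nine_le_choose_two_pred_add_eight (k : ℕ) (hk : 9 ≤ k) :
    3 * k + 9 ≤ (k - 1).choose 2 + 8 := by
  obtain ⟨j, rfl⟩ : ∃ j, k = j + 9 := ⟨k - 9, by omega⟩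
  have e : j + 9 - 1 = j + 8 := by omega
  rw [e]
  have hC := two_mul_choose_two_add (j + 8)
  nlinarith [hC]

/-- `ag ≥ 2` for `a, g ≥ 1` with `a + g ≥ 3`. -/
theorem two_le_mul_of_three_le_add (a g : ℕ) (ha : 1 ≤ a) (hg : 1 ≤ g) (h : 3 ≤ a + g) : 2 ≤ a * g := by
  rcases Nat.lt_or_ge a 2 with h2 | h2
  · have : a = 1 := by omega
    subst this
    omega
  · have := Nat.mul_le_mul h2 hg
    omega

/-- The final arithmetic of the row `m = k + 3`: with `d = a + 5`, `k = a + 6 + g`, `m = a + 9 + g`,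
`|R| = 2g + 8`, the combined bound and `2T + 8 ≤ Y + 4ag` give `cherries ≤ C(k − 1, 2) + 8`. -/
theorem row_plus_three_arith (s2 Y T a g ch C : ℕ)
    (hfin : 2 * s2 + (2 * g + 8) * (a + 5) + Y ≤ 2 * ((a + 5) * (a + 5)) + 2 * (a + 5) +
      2 * (2 * g + 8) + 2 * T + (2 * g + 8) * (a + 9 + g) + (2 * g + 8))
    (hc : 2 * ch + 2 * (a + 9 + g) = s2) (hC : 2 * C + (a + 5 + g) = (a + 5 + g) * (a + 5 + g))
    (hkey : 2 * T + 8 ≤ Y + 4 * (a * g)) : ch ≤ C + 8 := by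
  nlinarith [hfin, hc, hC, hkey]

/-- **THE ROW `m = k + 3`:** every `K₄⁻`-free graph with `k + 3` edges on `k ≥ 9` vertices has
`Σ_v C(d(v), 2) ≤ C(k − 1, 2) + 8`. -/
theorem cherries_le_choose_two_add_eight_of_k4mFree (D : SimpleGraph V) [DecidableRel D.Adj]
    (hK : K4mFree D) (hk : 9 ≤ Fintype.card V) (hm : D.edgeFinset.card = Fintype.card V + 3) :
    cherries D ≤ (Fintype.card V - 1).choose 2 + 8 := by
  by_cases hdeg : ∀ v, deg D v ≤ 4
  · -- every degree `≤ 4`: `2·cherries ≤ 3 Σ d = 6m`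
    have h2 : 2 * cherries D ≤ 3 * ∑ v, deg D v := by
      unfold cherries
      rw [mul_sum, mul_sum]
      exact sum_le_sum (fun v _ => two_mul_choose_two_le_three_mul_of_le_four _ (hdeg v))
    rw [sum_deg_eq, hm] at h2
    have := three_mul_add_nine_le_choose_two_pred_add_eight (Fintype.card V) hk
    omega
  · push Not at hdeg
    obtain ⟨u, hu⟩ := hdeg
    -- a vertex of maximum degree, of degree `≥ 5`
    obtain ⟨v, -, hmax⟩ := exists_max_image univ (deg D) ⟨u, mem_univ u⟩
    have hmax' : ∀ w, deg D w ≤ deg D v := fun w => hmax w (mem_univ w)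
    have hv : 5 ≤ deg D v := by
      have := hmax' u
      omega
    -- the split of `2 Σ d²` (TriangleCapDiagonal) and the counts at `v`
    have hS := sum_adjPairsAll_deg_add D
    have hsplit1 := sum_filter_add_sum_filter_not (adjPairsAll D) (fun p => p.1 = v)
      (fun p => deg D p.1 + deg D p.2)
    have hsplit2 := sum_filter_add_sum_filter_not ((adjPairsAll D).filter (fun p => ¬ p.1 = v))
      (fun p => p.2 = v) (fun p => deg D p.1 + deg D p.2)
    rw [filter_not_fst_filter_snd, filter_not_fst_filter_not_snd] at hsplit2
    have hfst := sum_filter_fst_deg_add D v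
    have hsnd := sum_filter_snd_deg_add D v
    have hA := sum_deg_neighbors_eq D v
    have hE := two_mul_card_E_le D v
    have hT := card_T_le_deg D hK v
    have hTR : ((offPairs D v).filter (fun p => D.Adj v p.1 ∧ D.Adj v p.2)).card ≤
      (offPairs D v).card := card_filter_le _ _
    have hRc := two_mul_card_edges_eq D v
    have hR1 := sum_R_add_sum_avoid_le D v
    have hc := two_mul_cherries_add D
    rw [sum_deg_eq] at hc
    have hdk : deg D v + 1 ≤ Fintype.card V := by
      have hsub : univ.filter (fun w => D.Adj v w) ⊆ univ.erase v := by
        intro w hw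
        rw [mem_filter] at hw
        rw [mem_erase]
        exact ⟨(D.ne_of_adj hw.2).symm, mem_univ _⟩
      have h1 : deg D v ≤ (univ.erase v).card := card_le_card hsub
      rw [card_erase_of_mem (mem_univ v), card_univ] at h1
      have h2 : 1 ≤ Fintype.card V := Fintype.card_pos_iff.mpr ⟨v⟩
      omega
    -- the combined linear bound with the defect sum
    have hmain : 2 * (∑ x, deg D x * deg D x) + (offPairs D v).card * deg D v +
        ∑ p ∈ offPairs D v, (avoid D v p).card ≤
        2 * (deg D v * deg D v) + 2 * deg D v +
          4 * ((offPairs D v).filter (fun p => D.Adj v p.1)).card +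
          (offPairs D v).card * D.edgeFinset.card + (offPairs D v).card := by
      linarith [hS, hsplit1, hsplit2, hfst, hsnd, hA, hR1]
    -- the structural facts, instantiated
    have hTT := card_T_mul_card_T_le D hK v
    have hthree : 3 ≤ ((offPairs D v).filter (fun p => D.Adj v p.1 ∧ D.Adj v p.2)).card →
        (offPairs D v).card ≤ ∑ p ∈ offPairs D v, (avoid D v p).card :=
      fun h => card_offPairs_le_sum_avoid_of_three_le D hK v h
    have heven := card_T_eq_two_mul D v
    have hdom : deg D v + 1 = Fintype.card V →
        ((offPairs D v).filter (fun p => D.Adj v p.1 ∧ D.Adj v p.2)).card = (offPairs D v).card :=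
      fun h => congrArg card (filter_T_eq_offPairs_of_deg_add_one_eq_card D h)
    have hfour : 4 ≤ (offEdges D v).card →
        0 < ((offPairs D v).filter (fun p => D.Adj v p.1 ∧ D.Adj v p.2)).card →
        Fintype.card V < D.edgeFinset.card → 4 ≤ ∑ p ∈ offPairs D v, (avoid D v p).card :=
      fun h1 h2 h3 => four_le_sum_avoid_of_card_lt D hK v h1 h2 h3
    have hEc := card_offEdges D v
    -- a vertex `c` of maximum off-degree, for the case of maximum degree `5`
    obtain ⟨c, -, hcmax⟩ := exists_max_image univ (outDeg D v) ⟨v, mem_univ v⟩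
    have hcmax' : ∀ w, outDeg D v w ≤ outDeg D v c := fun w => hcmax w (mem_univ w)
    have hδd : outDeg D v c ≤ deg D v := (outDeg_le_deg D v c).trans (hmax' c)
    have hδ1 := sum_avoid_ge_of_outDeg D v c
    have hδ2 : outDeg D v c ≤ 3 →
        (offPairs D v).card * ((offEdges D v).card + 1 - 2 * 3) ≤ ∑ p ∈ offPairs D v, (avoid D v p).card :=
      fun h => sum_avoid_ge_of_outDeg_le D v 3 (fun w => (hcmax' w).trans h)
    -- names for the quantities
    set T := ((offPairs D v).filter (fun p => D.Adj v p.1 ∧ D.Adj v p.2)).card with hTdef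
    set M := (((offPairs D v).filter (fun p => D.Adj v p.1 ∧ D.Adj v p.2)).image
      (fun q => s(q.1, q.2))).card with hMdef
    set E := ((offPairs D v).filter (fun p => D.Adj v p.1)).card with hEdef
    set Rc := (offPairs D v).card with hRcdef
    set Y := ∑ p ∈ offPairs D v, (avoid D v p).card with hYdef
    set Ec := (offEdges D v).card with hEcdef
    set δ := outDeg D v c with hδdef
    set d := deg D v with hddef
    set m := D.edgeFinset.card with hmdef
    set k := Fintype.card V with hkdef
    set ch := cherries D with hchdef
    set s2 := ∑ x, deg D x * deg D x with hs2def
    clear_value T M E Rc Y Ec δ d m k ch s2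
    have hfin : 2 * s2 + Rc * d + Y ≤ 2 * (d * d) + 2 * d + 2 * Rc + 2 * T + Rc * m + Rc := by
      linarith [hmain, hE]
    clear hmain hS hsplit1 hsplit2 hfst hsnd hA hR1 hE hTdef hMdef hEdef hRcdef hYdef hEcdef hδdef hddef
      hmdef hkdef hchdef hs2def hmax hmax' hcmax hcmax' hu
    obtain ⟨a, rfl⟩ : ∃ a, d = a + 5 := ⟨d - 5, by omega⟩
    obtain ⟨g, rfl⟩ : ∃ g, k = a + 6 + g := ⟨k - (a + 6), by omega⟩
    have hm' : m = a + 9 + g := by omega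
    subst hm'
    have hRc' : Rc = 2 * g + 8 := by omega
    subst hRc'
    have hEc' : Ec = g + 4 := by omega
    subst hEc'
    have e1 : a + 6 + g - 1 = a + 5 + g := by omega
    rw [e1]
    have hC := two_mul_choose_two_add (a + 5 + g)
    have hk3 : 3 ≤ a + g := by omega
    -- the defect sum at maximum degree `5`: `Y ≥ 16`
    have h16 : a = 0 → 16 ≤ Y := by
      intro ha
      subst ha
      by_cases hδ4 : 4 ≤ δ
      · have hδ5 : δ ≤ 5 := by omega
        interval_cases δ <;> omega
      · have h := hδ2 (by omega)
        obtain ⟨g', rfl⟩ : ∃ g', g = g' + 3 := ⟨g - 3, by omega⟩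
        have e : g' + 3 + 4 + 1 - 2 * 3 = g' + 2 := by omega
        rw [e] at h
        have h' : 14 * 2 ≤ (2 * (g' + 3) + 8) * (g' + 2) :=
          Nat.mul_le_mul (by omega) (by omega)
        omega
    -- THE KEY INEQUALITY: `2T + 8 ≤ Y + 4ag` in every case
    have hkey : 2 * T + 8 ≤ Y + 4 * (a * g) := by
      by_cases h8 : 8 ≤ T
      · have h := Nat.mul_le_mul_right T h8
        omega
      · by_cases h6 : 6 ≤ T
        · have hT6 : T = 6 := by omega
          rcases Nat.eq_zero_or_pos g with hg | hg
          · subst hg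
            have := hdom (by omega)
            omega
          · have hag : 2 ≤ a * g := two_le_mul_of_three_le_add a g (by omega) hg hk3
            subst hT6
            omega
        · by_cases h3 : 3 ≤ T
          · have hT4 : T = 4 := by omega
            subst hT4
            have hY := hthree (by norm_num)
            rcases Nat.eq_zero_or_pos g with hg | hg
            · subst hg
              have := hdom (by omega)
              omega
            · rcases Nat.eq_zero_or_pos a with ha | ha
              · have := h16 ha
                subst ha
                omega
              · have hag : 2 ≤ a * g := two_le_mul_of_three_le_add a g ha hg hk3
                omega
          · rcases Nat.eq_zero_or_pos g with hg | hg
            · subst hg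
              have := hdom (by omega)
              omega
            · rcases Nat.eq_zero_or_pos a with ha | ha
              · have := h16 ha
                subst ha
                omega
              · have hag : 2 ≤ a * g := two_le_mul_of_three_le_add a g ha hg hk3
                rcases Nat.eq_zero_or_pos T with hT0 | hT0
                · omega
                · have hY4 := hfour (by omega) hT0 (by omega)
                  omega
    exact row_plus_three_arith s2 Y T a g ch _ hfin hc hC hkey

/-- The row `m = k + 3` on `Fin k`, `k ≥ 9`: every `K₄⁻`-free `D` with `k + 3` edges has
`cherries D ≤ C(k − 1, 2) + 8`. -/
theorem cherries_le_of_card_edges_eq_add_three (k : ℕ) (hk : 9 ≤ k) (D : SimpleGraph (Fin k))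
    [DecidableRel D.Adj] (hK : K4mFree D) (hm : D.edgeFinset.card = k + 3) :
    cherries D ≤ (k - 1).choose 2 + 8 := by
  have := cherries_le_choose_two_add_eight_of_k4mFree D hK (by simpa using hk) (by rw [hm]; simp)
  simpa using this

end C047

end TriangleCap

end PercRepro
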